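import Summits.ResolutionOfSingularities.ResolutionOfSingularities.Theses.RisoStrata

/-!
# Route RisoStrata — `RtdUpperSemicontinuous` (stmt-ResolutionOfSingularities-18552): the `r = 0` slice
# and the reduction to `r ≥ 1`

The route decl `RtdUpperSemicontinuous` (Monreal, arXiv:2606.12554, Question 6.4, typed in characteristic `p`
for finitely generated `k`-subalgebras `B ⊆ K`, `k` algebraically closed) asks that, for every `r : ℕ`, the set
of maximal ideals `m` of `B` with `Rtd B m r` (typed riso-triviality dimension `≥ r`: a presentation of `B` by
generators vanishing at `m`, a `k`-subspace `W ⊆ kⁿ` of dimension `≥ r`, and an rv-preserving straightener of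
the Hahn-series arcs centred at `m` whose image is invariant under `W`-translations of positive order) is open
among closed points.

This file records, sorry-free, the part of the statement that is elementary:

* `exists_sub_algebraMap_mem_of_isMaximal`, `exists_generators_mem_of_isMaximal` — weak Nullstellensatz
  plumbing: every maximal ideal of a finitely generated `k`-subalgebra of a field extension of an algebraically
  closed `k` is `k`-rational, hence admits a presentation by generators vanishing there;
* `adjoin_range_eq_top_of_adjoin_coe_eq` — a presentation in `K` generates `B` itself, so arcs agreeing on the
  generators agree;
* `rtd_zero` — `Rtd B m 0` holds at every maximal ideal (identity straightener, `W = ⊥`);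
* `rtdUpperSemicontinuous_zero` — the `r = 0` slice of the route decl;
* `rtdUpperSemicontinuous_of_pos` — the route decl follows from its `r ≥ 1` slice (which is Monreal's printed
  open Question 6.4 in characteristic `p`).

No claim is made here about `r ≥ 1`.
-/

noncomputable section

set_option linter.dupNamespace false -- mandated namespace of this single-conjunct summit

namespace Summit.ResolutionOfSingularities.ResolutionOfSingularities.Theorems

open Summit.ResolutionOfSingularities.ResolutionOfSingularities.Theses.RisoStrata

/-- Weak Nullstellensatz for a finitely generated subalgebra `B ⊆ K` over an algebraically closed field `k`:
every maximal ideal `m` of `B` is `k`-rational, i.e. every `b : B` is congruent modulo `m` to a scalar.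
[folklore] -/
theorem exists_sub_algebraMap_mem_of_isMaximal {k K : Type} [Field k] [IsAlgClosed k] [Field K]
    [Algebra k K] (B : Subalgebra k K) (hB : B.FG) (m : Ideal ↥B) [hm : m.IsMaximal] (b : ↥B) :
    ∃ c : k, b - algebraMap k ↥B c ∈ m := by
  haveI : Algebra.FiniteType k ↥B := (Subalgebra.fg_iff_finiteType B).mp hB
  letI : Field (↥B ⧸ m) := Ideal.Quotient.field m
  haveI : Module.Finite k (↥B ⧸ m) := finite_of_finite_type_of_isJacobsonRing k (↥B ⧸ m)
  haveI : Algebra.IsIntegral k (↥B ⧸ m) := Algebra.IsIntegral.of_finite k _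
  obtain ⟨c, hc⟩ :=
    (IsAlgClosed.algebraMap_bijective_of_isIntegral (k := k) (K := ↥B ⧸ m)).2 (Ideal.Quotient.mk m b)
  refine ⟨c, ?_⟩
  rw [← Ideal.Quotient.eq_zero_iff_mem, map_sub, ← hc, Ideal.Quotient.mk_algebraMap, sub_self]

/-- Every maximal ideal `m` of a finitely generated subalgebra `B ⊆ K` (`k` algebraically closed) admits a
finite presentation of `B` by generators lying in `m` ("a closed point can be moved to the origin").
[folklore] -/
theorem exists_generators_mem_of_isMaximal {k K : Type} [Field k] [IsAlgClosed k] [Field K]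
    [Algebra k K] (B : Subalgebra k K) (hB : B.FG) (m : Ideal ↥B) [hm : m.IsMaximal] :
    ∃ (n : ℕ) (g : Fin n → ↥B), (∀ i, g i ∈ m) ∧
      Algebra.adjoin k (Set.range fun i => (g i : K)) = B := by
  haveI hft : Algebra.FiniteType k ↥B := (Subalgebra.fg_iff_finiteType B).mp hB
  obtain ⟨n, f, hf⟩ := Algebra.FiniteType.iff_quotient_mvPolynomial''.mp hft
  choose c hc using fun i : Fin n =>
    exists_sub_algebraMap_mem_of_isMaximal B hB m (f (MvPolynomial.X i))
  refine ⟨n, fun i => f (MvPolynomial.X i) - algebraMap k ↥B (c i), hc, ?_⟩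
  apply le_antisymm
  · refine Algebra.adjoin_le ?_
    rintro _ ⟨i, rfl⟩
    exact SetLike.coe_mem _
  · -- `B` is generated by the `f (X i)`, each of which lies in the new adjoin
    have hgen : (B : Subalgebra k K) ≤ Algebra.adjoin k (Set.range fun i => (f (MvPolynomial.X i) : K)) := by
      intro x hx
      obtain ⟨P, hP⟩ := hf ⟨x, hx⟩
      rw [Algebra.adjoin_range_eq_range_aeval]
      refine ⟨P, ?_⟩
      have h := MvPolynomial.aeval_unique (B.val.comp f)
      have h2 : (MvPolynomial.aeval fun i => (f (MvPolynomial.X i) : K)) P = (B.val.comp f) P := by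
        rw [h]; rfl
      change (MvPolynomial.aeval fun i => (f (MvPolynomial.X i) : K)) P = x
      rw [h2, AlgHom.comp_apply, hP]
      rfl
    refine hgen.trans (Algebra.adjoin_le ?_)
    rintro _ ⟨i, rfl⟩
    have h1 : (f (MvPolynomial.X i) : K) =
        ((f (MvPolynomial.X i) - algebraMap k ↥B (c i) : ↥B) : K) + algebraMap k K (c i) := by
      simp
    change (f (MvPolynomial.X i) : K) ∈
      Algebra.adjoin k (Set.range fun i => ((f (MvPolynomial.X i) - algebraMap k ↥B (c i) : ↥B) : K))
    rw [h1]
    exact add_mem (Algebra.subset_adjoin ⟨i, rfl⟩) (Subalgebra.algebraMap_mem _ _)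

/-- If a tuple `g` of elements of a subalgebra `B ⊆ K` generates `B` *as a subalgebra of `K`*, then it
generates `B` as a `k`-algebra (`Algebra.adjoin k (range g) = ⊤` in `↥B`); in particular two `k`-algebra maps
out of `B` that agree on the `g i` are equal. [folklore] -/
theorem adjoin_range_eq_top_of_adjoin_coe_eq {k K : Type} [Field k] [Field K] [Algebra k K]
    (B : Subalgebra k K) {n : ℕ} (g : Fin n → ↥B)
    (hg : Algebra.adjoin k (Set.range fun i => (g i : K)) = B) :
    Algebra.adjoin k (Set.range g) = ⊤ := by
  have h1 : (Set.range fun i => (g i : K)) = B.val '' Set.range g := by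
    rw [← Set.range_comp]
    rfl
  rw [h1, Algebra.adjoin_image] at hg
  apply Subalgebra.map_injective (f := B.val) Subtype.val_injective
  rw [hg, Algebra.map_top, Subalgebra.range_val]

/-- **`Rtd B m 0` at every closed point.** For a finitely generated subalgebra `B ⊆ K` over an algebraically
closed field `k` and a maximal ideal `m`, the typed riso-triviality condition of route RisoStrata holds with
`r = 0`: take any presentation by generators in `m` (`exists_generators_mem_of_isMaximal`), `W = ⊥`, and the
identity straightener `φ a = (a (g i))_i`; the rv-condition reduces to "distinct arcs differ on some generator",
and `W = ⊥` makes translation invariance vacuous (`w = 0`). This is the let-expanded `Rtd B m 0` of the route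
file, verbatim up to `r := 0`. [folklore] -/
theorem rtd_zero {k K : Type} [Field k] [IsAlgClosed k] [Field K] [Algebra k K]
    (B : Subalgebra k K) (hB : B.FG) (m : Ideal ↥B) [hm : m.IsMaximal] :
    ∃ (n : ℕ) (g : Fin n → ↥B), (∀ i, g i ∈ m) ∧ Algebra.adjoin k (Set.range fun i => (g i : K)) = B ∧
      ∃ W : Submodule k (Fin n → k), 0 ≤ Module.finrank k ↥W ∧
        ∃ φ : {α : ↥B →ₐ[k] HahnSeries ℚ k // ∀ b ∈ m, 0 < (α b).orderTop} → (Fin n → HahnSeries ℚ k),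
          (∀ a b : {α : ↥B →ₐ[k] HahnSeries ℚ k // ∀ b ∈ m, 0 < (α b).orderTop}, a ≠ b →
              ∃ j, ∀ i, (a.1 (g j) - b.1 (g j)).orderTop <
                ((φ a i - φ b i) - (a.1 (g i) - b.1 (g i))).orderTop) ∧
          (∀ a i, 0 < (φ a i).orderTop) ∧
          (∀ a, ∀ w : Fin n → HahnSeries ℚ k, (∀ i, 0 < (w i).orderTop) →
              w ∈ Submodule.span (HahnSeries ℚ k)
                ((fun u : Fin n → k => fun i => HahnSeries.C (u i)) '' (W : Set (Fin n → k))) →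
                ∃ b, φ b = φ a + w) := by
  obtain ⟨n, g, hg, hgen⟩ := exists_generators_mem_of_isMaximal B hB m
  refine ⟨n, g, hg, hgen, ⊥, Nat.zero_le _, fun a i => a.1 (g i), ?_, fun a i => a.2 (g i) (hg i), ?_⟩
  · intro a b hab
    have hex : ∃ j, a.1 (g j) ≠ b.1 (g j) := by
      by_contra hcon
      push Not at hcon
      apply hab
      apply Subtype.ext
      exact AlgHom.ext_of_adjoin_eq_top (adjoin_range_eq_top_of_adjoin_coe_eq B g hgen)
        (by rintro _ ⟨j, rfl⟩; exact hcon j)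
    obtain ⟨j, hj⟩ := hex
    refine ⟨j, fun i => ?_⟩
    rw [sub_self, HahnSeries.orderTop_zero]
    exact HahnSeries.orderTop_lt_top.mpr (sub_ne_zero.mpr hj)
  · intro a w _ hw
    refine ⟨a, ?_⟩
    have hw0 : w = 0 := by
      rw [Submodule.bot_coe, Set.image_singleton] at hw
      have h0 : (fun i : Fin n => HahnSeries.C ((0 : Fin n → k) i)) = (0 : Fin n → HahnSeries ℚ k) := by
        funext i
        simp
      rw [h0, Submodule.span_zero_singleton, Submodule.mem_bot] at hw
      exact hw
    rw [hw0, add_zero]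

/-- **The `r = 0` slice of `RtdUpperSemicontinuous`.** With `r = 0` the typed condition `Rtd B m 0` holds at
every maximal ideal (`rtd_zero`), so the locus is all of `MaxSpec B` and `s = 1` witnesses openness. The
statement is the route decl `RisoStrata.RtdUpperSemicontinuous` verbatim with `∀ r` specialised to `0`.
[folklore] -/
theorem rtdUpperSemicontinuous_zero : ∀ p : ℕ, p.Prime → ∀ (k : Type) [Field k] [CharP k p] [IsAlgClosed k] (K : Type) [Field K] [Algebra k K] (B : Subalgebra k K), B.FG → let Arc : ∀ (B : Subalgebra k K), Ideal ↥B → Type := fun B m => {α : ↥B →ₐ[k] HahnSeries ℚ k // ∀ b ∈ m, 0 < (α b).orderTop}; let Rtd : ∀ (B : Subalgebra k K), Ideal ↥B → ℕ → Prop := fun B m r => ∃ (n : ℕ) (g : Fin n → ↥B), (∀ i, g i ∈ m) ∧ Algebra.adjoin k (Set.range fun i => (g i : K)) = B ∧ ∃ W : Submodule k (Fin n → k), r ≤ Module.finrank k ↥W ∧ ∃ φ : Arc B m → (Fin n → HahnSeries ℚ k), (∀ a b : Arc B m, a ≠ b → ∃ j, ∀ i, (a.1 (g j) - b.1 (g j)).orderTop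 < ((φ a i - φ b i) - (a.1 (g i) - b.1 (g i))).orderTop) ∧ (∀ a i, 0 < (φ a i).orderTop) ∧ (∀ a, ∀ w : Fin n → HahnSeries ℚ k, (∀ i, 0 < (w i).orderTop) → w ∈ Submodule.span (HahnSeries ℚ k) ((fun u : Fin n → k => fun i => HahnSeries.C (u i)) '' (W : Set (Fin n → k))) → ∃ b, φ b = φ a + w); ∀ (m : Ideal ↥B), m.IsMaximal → Rtd B m 0 → ∃ s : ↥B, s ∉ m ∧ ∀ (m'' : Ideal ↥B), m''.IsMaximal → s ∉ m'' → Rtd B m'' 0 := by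
  intro p _ k _ _ _ K _ _ B hB Arc Rtd m hm _
  refine ⟨1, Ideal.ne_top_iff_one m |>.mp hm.ne_top, fun m'' hm'' _ => ?_⟩
  exact rtd_zero B hB m''

/-- **Reduction of `RtdUpperSemicontinuous` to `r ≥ 1`.** The route decl follows from its slice over `r ≥ 1`
(the `r = 0` slice being `rtdUpperSemicontinuous_zero`). The hypothesis is the route decl verbatim with
`∀ r : ℕ,` strengthened to `∀ r : ℕ, 1 ≤ r →`; it is Monreal's printed open Question 6.4
(arXiv:2606.12554, p. 25) in characteristic `p` for the route's typed riso-triviality dimension, and is NOT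
proved here. [folklore] -/
theorem rtdUpperSemicontinuous_of_pos (h : ∀ p : ℕ, p.Prime → ∀ (k : Type) [Field k] [CharP k p] [IsAlgClosed k] (K : Type) [Field K] [Algebra k K] (B : Subalgebra k K), B.FG → let Arc : ∀ (B : Subalgebra k K), Ideal ↥B → Type := fun B m => {α : ↥B →ₐ[k] HahnSeries ℚ k // ∀ b ∈ m, 0 < (α b).orderTop}; let Rtd : ∀ (B : Subalgebra k K), Ideal ↥B → ℕ → Prop := fun B m r => ∃ (n : ℕ) (g : Fin n → ↥B), (∀ i, g i ∈ m) ∧ Algebra.adjoin k (Set.range fun i => (g i : K)) = B ∧ ∃ W : Submodule k (Fin n → k), r ≤ Module.finrank k ↥W ∧ ∃ φ : Arc B m → (Fin n → HahnSeries ℚ k), (∀ a b : Arc B m, a ≠ b → ∃ j, ∀ i, (a.1 (g j) - b.1 (g j)).orderTop < ((φ a i - φ b i) - (a.1 (g i) - b.1 (g i))).orderTop) ∧ (∀ a i, 0 < (φ a i).orderTop) ∧ (∀ a, ∀ w : Fin n → HahnSeries ℚ k, (∀ i, 0 < (w i).orderTop) → w ∈ Submodule.span (HahnSeries ℚ k)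 ((fun u : Fin n → k => fun i => HahnSeries.C (u i)) '' (W : Set (Fin n → k))) → ∃ b, φ b = φ a + w); ∀ r : ℕ, 1 ≤ r → ∀ (m : Ideal ↥B), m.IsMaximal → Rtd B m r → ∃ s : ↥B, s ∉ m ∧ ∀ (m'' : Ideal ↥B), m''.IsMaximal → s ∉ m'' → Rtd B m'' r) :
    RtdUpperSemicontinuous := by
  unfold RtdUpperSemicontinuous
  intro p hp k _ _ _ K _ _ B hB Arc Rtd r m hm hr
  rcases Nat.eq_zero_or_pos r with rfl | hr1
  · exact rtdUpperSemicontinuous_zero p hp k K B hB m hm hr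
  · exact h p hp k K B hB r hr1 m hm hr

end Summit.ResolutionOfSingularities.ResolutionOfSingularities.Theorems
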